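import Literature.IUT.HodgeTheaters.PiAvatarBaseKitThetaNFInstances
import Literature.IUT.HodgeTheaters.InitialThetaDataBadLocalFrobenioid
import Literature.IUT.HodgeTheaters.InitialThetaDataGoodLocalFrobenioid
import Literature.IUT.HodgeTheaters.InitialThetaDataArrowOpenDerived
import Literature.IUT.HodgeTheaters.LocalFrobenioidsArchModel
import Literature.IUT.HodgeTheaters.FPrimeStrips
import HarnessLib

/-!
# The GENUINE `ℱ`-kit over the genuine [IUTchI] §6 base kit of record, read bottom-up from Example 3.2:
# `InitialThetaData.MergeInputs` (the named upstream merge objects as ONE record) and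
# `InitialThetaData.genuineFKitOfBadLocal … (I : MergeInputs …) : (baseKitThetaNFOfBadPairs …).FKit (multKitThetaNFOfBadPairs …)`

S. Mochizuki, *Inter-universal Teichmüller theory I*, kurims manuscript (May 2020): Def. 5.2 (i)–(iv) pp. 134–135 («an
`ℱ`-prime-strip is a collection of data `‡𝔉 = {‡ℱ_v}_{v∈𝕍}` … if `v ∈ 𝕍^non`, then `‡ℱ_v` is a category `‡𝒞_v` which admits an
equivalence of categories `‡𝒞_v ⥲ 𝒞_v` [where `𝒞_v` is as in Examples 3.2, (iii); 3.3, (i)] … if `v ∈ 𝕍^arc`, … as in Example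
3.4, (i)»), Rmk. 5.2.1 (i)(ii) p. 143 (`𝔉 ↦ 𝔇`, `𝔉 ↦ 𝔉^⊢`, `𝔉 ↦ 𝔉^⊩`), Ex. 3.2 pp. 69–73, Ex. 3.3 (i) p. 78, Ex. 3.4 (i) p. 80,
Ex. 3.5 (i)(ii) pp. 84–86, Def. 6.1 (i)(ii) p. 156 ([IUTchI] Def 5.2 (i) p.134) [claim: Mochizuki2012, status: disputed] (D-0012
claim key, series status DISPUTED — a CONSTRUCTION over abc-iut-L5-t2's REAL `InitialThetaData` and the cell's landed typings;
nothing of the series is asserted; no side is taken on [IUTchIII] Cor. 3.12).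

L5 BASE-MERGE RACE (abc-iut-L5-lead 2026-08-27T03:53:32Z; racer C «bottom-up Ex. 3.2»).  THE MERGE = abc-iut-L5-t4's
`PMBaseKit.FKit` (`FPrimeStrips.lean`) over THE GENUINE §6 BASE KIT OF RECORD `D.baseKitThetaNFOfBadPairs CG hS M hA hI B ΛBad` /
`D.multKitThetaNFOfBadPairs … ES` (abc-iut-w5-d129 `PiAvatarBaseKitThetaNFInstances.lean`; TOKEN EDIT v2.6: parametric bad-pair DATA
`B`, NF half = the labelled Θ-NF stand-in), the upstream merge objects entering ONLY through ONE record `I`: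
* §0 PLACE PLUMBING (new): a nonarchimedean index `x` of the kit's copy of `V̲` names a finite place `finPlaceAt x` of `K`, its
  prime `specAt x`, its residue characteristic `primeAt x` (PRIME, `primeAt_prime`; `primeAt_mem`), the Galois-valuation datum
  `gvdAt x = GaloisValDatum.ofPlace K p w hw` (`K_v̲ = K_w`, `Ω = K̄_w`; abc-iut-L5-t2 p414147); at a bad index the place `placeBelow x
  ∈ V(F)^bad` below it (`placeBelow_mem_VFbad`, `liesOver_placeBelow`) and the GENUINE `q̲_v̲ = qRootAtIdx x` (p442528) — THEOREMS.
* §1 (M0) `MergeInputs D CG hS M hA hI B ΛBad`: fields EXACTLY the named merge objects of the L5 hub (abc-iut-L5-lead «L5 HUB (27)»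
  2026-08-27T03:05:03Z) that THIS kit consumes, as DATA + LAW hypotheses: `m2 x hx` = the Ex. 3.2 (i)/(ii)/(v) group datum
  `BadLocalGroupDatum Gal(K̄_w/K_w) ↥(B x hx).H` ON THE PAIR'S OWN `Π_{X̳̲_v̲}` (its three laws: `aug` continuous and open, `Π_Ÿ` open,
  `aug(Π_Ÿ) = ⊤`; p437191); `m1 x hx` = the [EtTh] §5 tempered side of the Tate curve over it and the genuine `q̲_v̲` (`BadTemperedSide`,
  carriers + the `TemperedThetaInput` of p440826); `m4` = the Ex. 3.5 realified global side (`RealifiedGlobalSide`; the abc-iut-L1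
  [FrdI] Ex. 6.3 / abc-iut-w4-d050 `ModelFrobenioid` ⊛ objects enter BY NAME when `I` is inhabited); `geomTFG` = FACT F-0240 BY NAME
  (⇒ the Def. 3.1 (f) openness of `Π_{X̲→_K}`, abc-iut-L5-t2 `isOpen_PiXarrow_of_cuspGalois`).  (m3), (m5): not consumed ⇒ OMITTED.
* §2 (M2) `frobeniusAt I x : LocalFrobeniusRecord x` — THE GENUINE `ℱ`-PRIME-STRIP `{ℱ_v̲}_{v̲∈V̲}` as a dependent family:
  (S2) bad `x` ↦ `frobeniusBadAt = D.badLocalFrobenioidAt … (I.m2 x hx) (I.m1 x hx).Kt` (abc-iut-L5-t2 Ex. 3.2 assembly p442528: REAL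
  `q_v̲, q̲_v̲, 𝒟⊢, 𝒞⊢, τ⊢, 𝒟^Θ, 𝒞^Θ, 𝒞⊢ ⥲ 𝒞^Θ`; base `𝒟_v̲ = CosetCat ↥(B x hx).H` ON THE KIT'S OWN LOCAL GROUP — `frobeniusBadAt_Dv`,
  `sub_model_eq_of_mem_bad`); (S1) good nonarchimedean `x` ↦ `frobeniusGoodAt = D.goodLocalFrobenioidAt w p hw hX` (Ex. 3.3
  `GoodLocalFrobenioid.ofGalois` at the place, E33 chain p419029 → p461075 → p470112 → p490831; `hX` DISCHARGED from `I.geomTFG`, `hA`,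
  `CG`); (S3) archimedean `x` ↦ `ArchLocalFrobenioid.ofArchFrd` (Ex. 3.4 (i), REAL [FrdII] Ex. 3.3 `𝒞_v` at `K_v̲ ≅ ℂ`; `𝒟_v`/`𝒜_{𝒟_v}`
  = the A3-INTERFACE convention, as in abc-iut-L4-t14 C53ii/A1 p491595).
* §3 (M1) `genuineFKitOfBadLocal D CG hS M hA hI B ΛBad ES I` — built in UNIVERSE 0 (`F K Fbar : Type`, the universe of the
  genuine local records; the kit of record there is `PMBaseKit.{0}`, ambient objects = subgroups of `Π_{C_F}`, so `FAmb x : Type`) while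
  every record `BadLocalFrobenioid.{0}` / `GoodLocalFrobenioid.{0}` / `ArchLocalFrobenioid.{0}` (`Type`-valued fields) lives in `Type 1`:
  NO kit over the kit of record can store the records in its ambient categories.  Hence the `ℱ`-, `ℱ^⊢`-, `ℱ̲`-objects at `x` are the
  isomorphs of `𝒟_x` (codes, `PMBaseKit.IsLocal`), `toD` the inclusion (FULLY FAITHFUL) — LABEL (referee RULING #1 (3a), arbiter σ3):
  «isomorphisms of collections of data READ AS isomorphisms of their bases — Cor 5.3 (ii)/(iv) in kit form is thereby the recorded
tautology of 'FKit.ofBase'/'HodgeTheaterModel', NOT evidence for print» — and NO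
  Cor5.3(i–iv)/Cor5.6(i) token may be booked on this term (settled-as-typed); `toD_model = Iso.refl` ((S5) definitional), the realified
  side reads `‡𝔉^⊩` as (global part ∈ `I.m4.Glob`, `ℱ^⊢`-strip) with model `(I.m4.gModel, codes)` ((S4)); the Frobenioid CONTENT of the code
  `fModel x` is the §2 DICTIONARY, GENUINE at every index.
* (M3) BINDER CENSUS.  Kit term: {`CG`, `hS`, `M`, `hA`, `hI`, `B`, `ΛBad`, `ES`} (the kit of record's, verbatim) ∪ {`I`}; dictionary: {`CG`, `hA`,
  `B`, `I`, `x`, membership proofs, `Fact (primeAt x).Prime` where a statement needs it (= the theorem `fact_primeAt_prime`)}.  DATA in `I`: `m1`,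
  `m2`, `m4`; LAW in `I`: the fields of `m2 x hx` / `(m1 x hx).Kt`, FACT F-0240 `geomTFG` (named); FACT unnamed 0; LAW outside `I` 0;
  instance 0; notation 0; nothing restated; no `sorry`.  HONEST FRAMING: a genuine `ℱ`-kit modulo named upstream inputs is OUR object, not
  print's theorem; «genuine» = OUR kernel builds the §2 records from the REAL initial Θ-data at the place named by the index, the [EtTh] /
  tempered inputs being the displayed fields of `I`; nothing asserts that `I` is inhabited at the tempered fundamental groups of the actual
  curve; typed ≠ inhabited ≠ proved; nothing here asserts abc proved or refuted.
-/

noncomputable section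

namespace Literature.IUT.HodgeTheaters

open CategoryTheory _root_.NumberField _root_.IsDedekindDomain Literature.NumberTheory.NumberFields
  Literature.AlgebraicGeometry.Frobenioids Literature.AlgebraicGeometry.Frobenioids.PadicFrd
  Literature.AnabelianGeometry.SemiGraphs

variable {F K Fbar : Type} [Field F] [NumberField F] [Field K] [NumberField K] [Algebra F K]
  [Field Fbar] [Algebra F Fbar] [Algebra K Fbar] {E : WeierstrassCurve F}
  [E.IsElliptic] {l : ℕ} {Pb : BadPlacePredicates K} (D : InitialThetaData F K Fbar E l Pb)

namespace InitialThetaData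

/-! ### §0 Place plumbing: the place, prime, residue characteristic and Galois-valuation datum named by an index -/

/-- A nonarchimedean index of the copy of `V̲` names a nonarchimedean valuation. ([IUTchI] Def 3.1 (e) p.62) [claim: Mochizuki2012, status: disputed] -/
theorem isRight_indexCopyVal_of_not_mem_arc {x : D.IndexCopy} (hx : x ∉ D.indexCopyArc) : (D.indexCopyVal x).isRight := by
  rw [mem_indexCopyArc_iff] at hx
  rcases h : D.indexCopyVal x with a | w
  · refine absurd ⟨?_, ?_⟩ hx
    · exact (D.indexCopyEquiv x).2
    · rw [h]; simp [Val.IsArc]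
  · rfl

/-- **The finite place of `K` named by a nonarchimedean index.** ([IUTchI] Def 3.1 (e) p.62) [claim: Mochizuki2012, status: disputed] -/
def finPlaceAt (x : D.IndexCopy) (hx : x ∉ D.indexCopyArc) : FinitePlace K :=
  (D.indexCopyVal x).getRight (D.isRight_indexCopyVal_of_not_mem_arc hx)

/-- The index names `Sum.inr (finPlaceAt x)`. ([IUTchI] Def 3.1 (e) p.62) [claim: Mochizuki2012, status: disputed] -/
theorem indexCopyVal_eq_inr (x : D.IndexCopy) (hx : x ∉ D.indexCopyArc) : D.indexCopyVal x = Sum.inr (D.finPlaceAt x hx) := by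
  rw [finPlaceAt, Sum.inr_getRight]

/-- **The prime `w` of `𝓞_K` named by a nonarchimedean index** (`v̲ = w`). ([IUTchI] Def 3.1 (e) p.62) [claim: Mochizuki2012, status: disputed] -/
def specAt (x : D.IndexCopy) (hx : x ∉ D.indexCopyArc) : HeightOneSpectrum (𝓞 K) := (D.finPlaceAt x hx).maximalIdeal

/-- **The residue characteristic `p_v̲`** of the index («we shall write `p_v` for the residue characteristic of `v`»): the characteristic
of `𝓞_K / w`. ([IUTchI] §0 p.36) [claim: Mochizuki2012, status: disputed] -/
def primeAt (x : D.IndexCopy) (hx : x ∉ D.indexCopyArc) : ℕ := ringChar (𝓞 K ⧸ (D.specAt x hx).asIdeal)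

/-- `p_v̲` is prime (the nonzero absolute norm of `w` dies in `𝓞_K / w`). ([IUTchI] §0 p.36) [claim: Mochizuki2012, status: disputed] -/
theorem primeAt_prime (x : D.IndexCopy) (hx : x ∉ D.indexCopyArc) : (D.primeAt x hx).Prime := by
  set w := D.specAt x hx
  set R := 𝓞 K ⧸ w.asIdeal
  have hN : ((Ideal.absNorm w.asIdeal : ℕ) : R) = 0 := by
    rw [← map_natCast (Ideal.Quotient.mk w.asIdeal), Ideal.Quotient.eq_zero_iff_mem]
    exact Ideal.absNorm_mem w.asIdeal
  have hN0 : Ideal.absNorm w.asIdeal ≠ 0 := by rw [Ne, Ideal.absNorm_eq_zero_iff]; exact w.ne_bot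
  have hp0 : ringChar R ≠ 0 := fun h0 => hN0 (by rwa [ringChar.spec, h0, zero_dvd_iff] at hN)
  haveI := w.isMaximal
  exact (CharP.char_is_prime_or_zero R (ringChar R)).resolve_right hp0

/-- `p_v̲` is prime, as a `Fact` (a theorem installed with `haveI`, not an instance). ([IUTchI] §0 p.36) [claim: Mochizuki2012, status: disputed] -/
theorem fact_primeAt_prime (x : D.IndexCopy) (hx : x ∉ D.indexCopyArc) : Fact (D.primeAt x hx).Prime := ⟨D.primeAt_prime x hx⟩

/-- `v̲ ∣ p_v̲`: `(p_v̲ : 𝓞_K) ∈ w`. ([IUTchI] §0 p.36) [claim: Mochizuki2012, status: disputed] -/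
theorem primeAt_mem (x : D.IndexCopy) (hx : x ∉ D.indexCopyArc) : ((D.primeAt x hx : ℕ) : 𝓞 K) ∈ (D.specAt x hx).asIdeal := by
  rw [← Ideal.Quotient.eq_zero_iff_mem, map_natCast]
  exact ringChar.Nat.cast_ringChar

/-- **The Galois-valuation datum `(K_v̲, K̄_v̲)` at a nonarchimedean index**: `GaloisValDatum.ofPlace K p_v̲ w _` (abc-iut-L5-t2 p414147:
`K_v̲ = K_w`, `Ω = K̄_w`, spectral norm — every input discharged). ([IUTchI] Ex 3.3 (i) p.78) [claim: Mochizuki2012, status: disputed] -/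
def gvdAt (x : D.IndexCopy) (hx : x ∉ D.indexCopyArc) : @GaloisValDatum.{0} (D.primeAt x hx) (D.fact_primeAt_prime x hx) :=
  @GaloisValDatum.ofPlace K _ _ (D.primeAt x hx) (D.fact_primeAt_prime x hx) (D.specAt x hx) (D.primeAt_mem x hx)

/-- `G_v̲ = Gal(K̄_v̲/K_v̲)` at a nonarchimedean index (the Galois group of `gvdAt`). ([IUTchI] Def 3.1 (e) p.62) [claim: Mochizuki2012, status: disputed] -/
abbrev GalAt (x : D.IndexCopy) (hx : x ∉ D.indexCopyArc) : Type :=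
  @GaloisValDatum.Gal _ (D.fact_primeAt_prime x hx) (D.gvdAt x hx)

/-- A bad index is nonarchimedean (abc-iut-L5-t3 `indexCopy_not_mem_arc_of_mem_bad`). ([IUTchI] Def 3.1 (e) p.62) [claim: Mochizuki2012, status: disputed] -/
theorem not_mem_arc_of_mem_bad {x : D.IndexCopy} (hx : x ∈ D.indexCopyBad) : x ∉ D.indexCopyArc :=
  D.indexCopy_not_mem_arc_of_mem_bad x hx

/-- **The place `v ∈ V(F)` below a bad index** (`v̲ ∣ v`): the prime of `𝓞_F` under `w`. ([IUTchI] Def 3.1 (b) p.61) [claim: Mochizuki2012, status: disputed] -/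
def placeBelow (x : D.IndexCopy) (hx : x ∈ D.indexCopyBad) : FinitePlace F :=
  FinitePlace.mk ((D.specAt x (D.not_mem_arc_of_mem_bad hx)).under (𝓞 F))

/-- **`v ∈ V(F)^bad`** for the place below a bad index (`V̲^bad` = the members of `V̲` over `V^bad_mod`; unfolding of `toVMod`).
([IUTchI] Def 3.1 (b)(e) pp.61-62) [claim: Mochizuki2012, status: disputed] -/
theorem placeBelow_mem_VFbad (x : D.IndexCopy) (hx : x ∈ D.indexCopyBad) : D.placeBelow x hx ∈ D.VFbad := by
  have h := (D.mem_indexCopyBad_iff x).1 hx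
  rw [D.indexCopyVal_eq_inr x (D.not_mem_arc_of_mem_bad hx)] at h
  exact h.2

/-- `w` lies over `v`. ([IUTchI] Def 3.1 (e) p.62) [claim: Mochizuki2012, status: disputed] -/
theorem liesOver_placeBelow (x : D.IndexCopy) (hx : x ∈ D.indexCopyBad) :
    (D.specAt x (D.not_mem_arc_of_mem_bad hx)).asIdeal.LiesOver (D.placeBelow x hx).maximalIdeal.asIdeal := by
  rw [placeBelow, FinitePlace.maximalIdeal_mk]
  exact ⟨rfl⟩

/-- **The GENUINE `q̲_v̲ ∈ 𝒪^▷_{K_v̲}` at a bad index**: abc-iut-L5-t2's `qRootAt` (p442528; the `2l`-th root of the Tate parameter of `E_K`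
at `w`, UNCONDITIONAL over Def. 3.1 (b)(c)) at the place named by `x`. ([IUTchI] Ex 3.2 (iv) p.71) [claim: Mochizuki2012, status: disputed] -/
def qRootAtIdx (x : D.IndexCopy) (hx : x ∈ D.indexCopyBad) :
    intNonzero (@GaloisValDatum.k _ (D.fact_primeAt_prime x (D.not_mem_arc_of_mem_bad hx)) (D.gvdAt x _)) :=
  haveI : Fact (D.primeAt x (D.not_mem_arc_of_mem_bad hx)).Prime := D.fact_primeAt_prime x _
  haveI := D.liesOver_placeBelow x hx
  haveI := D.isScalarTower
  D.qRootAt (D.placeBelow_mem_VFbad x hx) (D.specAt x _) (D.primeAt x _) (D.primeAt_mem x _)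

/-- `q̲_v̲` is a non-unit (abc-iut-L5-t2 `qRootAt_not_isUnit`). ([IUTchI] Ex 3.2 (iv) p.71) [claim: Mochizuki2012, status: disputed] -/
theorem qRootAtIdx_not_isUnit (x : D.IndexCopy) (hx : x ∈ D.indexCopyBad) : ¬ IsUnit (D.qRootAtIdx x hx) :=
  haveI : Fact (D.primeAt x (D.not_mem_arc_of_mem_bad hx)).Prime := D.fact_primeAt_prime x _
  haveI := D.liesOver_placeBelow x hx
  haveI := D.isScalarTower
  D.qRootAt_not_isUnit (D.placeBelow_mem_VFbad x hx) (D.specAt x _) (D.primeAt x _) (D.primeAt_mem x _)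

/-! ### §1 (M0) `MergeInputs`: the named upstream merge objects, as ONE record of DATA + LAW hypotheses -/

section MergeRecord

variable (B : ∀ v, v ∈ D.indexCopyBad → D.BadPairAt v)

/-- **Hub object (m1) at a bad index: the [EtTh] §5 tempered side of the Tate curve at `v̲`** — carriers `ℱ̲_v`, `ℱ÷_v`, `𝒞_v` and
abc-iut-L5-t2's `TemperedThetaInput` (p440826: `ℱ̲_v → 𝒟_v` with `T_(−)`, `ℱ÷_v`, `Θ̲_v ∈ 𝒪^×(T^÷_{Ÿ_v})`, `l·ℤ`, constants, `𝒞_v ⊆ ℱ̲_v`,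
`𝒞⊢_v → 𝒞_v`, `𝒞^Θ_v ⊆ ℱ÷_v`) OVER the group datum `T` on the pair's `Π_{X̳̲_v̲}` and the GENUINE `q̲_v̲`; interface DATA of the L2 lane,
never asserted. ([IUTchI] Ex 3.2 (i)-(v) pp.69-73) [claim: Mochizuki2012, status: disputed] -/
structure BadTemperedSide (x : D.IndexCopy) (hx : x ∈ D.indexCopyBad)
    (T : BadLocalGroupDatum (D.GalAt x (D.not_mem_arc_of_mem_bad hx)) ↥(B x hx).H) : Type 1 where
  /-- the carrier of the tempered Frobenioid `ℱ̲_v` -/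
  Fv : Type
  /-- its category structure -/
  [catFv : Category.{0} Fv]
  /-- the carrier of the birationalization `ℱ÷_v` -/
  Fbirat : Type
  /-- its category structure -/
  [catFbirat : Category.{0} Fbirat]
  /-- the carrier of the base-field-theoretic hull `𝒞_v` -/
  Cv : Type
  /-- its category structure -/
  [catCv : Category.{0} Cv]
  /-- the tempered-side input of [IUTchI] Ex. 3.2 over `T` and the genuine `q̲_v̲` -/
  Kt : @TemperedThetaInput _ (D.fact_primeAt_prime x (D.not_mem_arc_of_mem_bad hx)) (D.gvdAt x _) _ _ _ T
    (D.qRootAtIdx x hx) (D.qRootAtIdx_not_isUnit x hx) Fv catFv Fbirat catFbirat Cv catCv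

/-- **Hub object (m4): the [IUTchI] Ex. 3.5 realified global side** — the category of the global parts `(‡𝒞^⊩, Prime(‡𝒞^⊩) ⥲ 𝕍, {‡ρ_v})`
of collections `‡𝔉^⊩` (Def. 5.2 (iv) (a)(b)(c)(e): «`‡𝒞^⊩` is a category [equipped with a Frobenioid structure] that is isomorphic to the
category `𝒞^⊩_mod` of Example 3.5, (i)»), with its model = the global part of `𝔉^⊩_mod` (Ex. 3.5 (ii)); the abc-iut-L1 [FrdI] Ex. 6.3 /
abc-iut-w4-d050 `ModelFrobenioid` ⊛ objects enter BY NAME when inhabited; interface DATA, never asserted.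
([IUTchI] Def 5.2 (iv) pp.134-135) [claim: Mochizuki2012, status: disputed] -/
structure RealifiedGlobalSide : Type 1 where
  /-- the category of global realified data `(‡𝒞^⊩, Prime(‡𝒞^⊩) ⥲ 𝕍, {‡ρ_v})` and their isomorphisms -/
  Glob : Type
  /-- its category structure -/
  [cat : Category.{0} Glob]
  /-- the model: the global part `(𝒞^⊩_mod, Prime(𝒞^⊩_mod) ⥲ 𝕍, {ρ_v})` of `𝔉^⊩_mod` (Example 3.5 (ii)) -/
  gModel : Glob

/-- **(M0) `MergeInputs` — the named upstream merge objects of the L5 hub that the genuine `ℱ`-kit consumes, ONE record of DATA +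
LAW hypotheses and nothing else**: (m2) the Ex. 3.2 group datum at each bad index on the pair's own `Π_{X̳̲_v̲}` (three laws), (m1) the
[EtTh] §5 tempered side over it, (m4) the Ex. 3.5 realified global side, FACT F-0240 by name; (m3), (m5) not consumed ⇒ omitted.
([IUTchI] Def 5.2 (i)-(iv) pp.134-135) [claim: Mochizuki2012, status: disputed] -/
structure MergeInputs : Type 1 where
  /-- (m2) the [IUTchI] Ex. 3.2 group datum `Π_v̲ → G_v̲ ⊇ Π_Ÿ` at each bad index, on the pair's `H = Π_{X̳̲_v̲}` -/
  m2 : ∀ x (hx : x ∈ D.indexCopyBad), BadLocalGroupDatum (D.GalAt x (D.not_mem_arc_of_mem_bad hx)) ↥(B x hx).H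
  /-- (m1) the [EtTh] §5 tempered side of the Tate curve at each bad index, over `m2` -/
  m1 : ∀ x (hx : x ∈ D.indexCopyBad), D.BadTemperedSide B x hx (m2 x hx)
  /-- (m4) the [IUTchI] Ex. 3.5 realified global side -/
  m4 : RealifiedGlobalSide
  /-- FACT F-0240 ([AbsTopI] Prop. 2.2 ⇒ [IUTchI] Rmk. 2.5.3 (ii)) `GeomTFG`, by name -/
  geomTFG : D.geom.extF.GeomTFG

end MergeRecord

/-! ### §2 (M2) the dictionary: the GENUINE local Frobenioid named by each index -/

section Dictionary

variable (CG : D.geom.pe.CuspGalois) (hA : D.geom.pe.ArrowCoveringClaims)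
  (B : ∀ v, v ∈ D.indexCopyBad → D.BadPairAt v) (I : D.MergeInputs B)

/-- **(S2) THE GENUINE BAD LOCAL FROBENIOID AT A BAD INDEX** — [IUTchI] Ex. 3.2 for `D` at `v̲` (abc-iut-L5-t2 `badLocalFrobenioidAt`,
p442528): REAL `q_v̲`, `q̲_v̲`, `𝒟⊢_v̲ = 𝓑(K_v̲)⁰`, `𝒞⊢_v̲`, `τ⊢_v̲`, `𝒟_v̲ = CosetCat Π_{X̳̲_v̲}`, `Ÿ_v̲`, `𝒟^Θ_v̲`, `𝒞^Θ_v̲`, `𝒞⊢_v̲ ⥲ 𝒞^Θ_v̲`, over `I.m2 x hx`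
on the kit's own `(B x hx).H`, tempered side ONLY through `I.m1 x hx`. ([IUTchI] Ex 3.2 pp.69-73) [claim: Mochizuki2012, status: disputed] -/
def frobeniusBadAt (x : D.IndexCopy) (hx : x ∈ D.indexCopyBad) :
    BadLocalFrobenioid.{0} l (@GaloisValDatum.k _ (D.fact_primeAt_prime x (D.not_mem_arc_of_mem_bad hx)) (D.gvdAt x _)) :=
  haveI : Fact (D.primeAt x (D.not_mem_arc_of_mem_bad hx)).Prime := D.fact_primeAt_prime x _
  haveI := D.liesOver_placeBelow x hx
  haveI := D.isScalarTower
  letI := (I.m1 x hx).catFv; letI := (I.m1 x hx).catFbirat; letI := (I.m1 x hx).catCv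
  D.badLocalFrobenioidAt (D.placeBelow_mem_VFbad x hx) (D.specAt x _) (D.primeAt x _) (D.primeAt_mem x _)
    (I.m2 x hx) (I.m1 x hx).Kt

/-- The base `𝒟_v̲` of the genuine bad local Frobenioid IS the coset category of the kit's own local group `(B x hx).H`,
and `𝒟⊢_v̲` IS `𝓑(K_v̲)⁰ = CosetCat Gal(K̄_w/K_w)`. ([IUTchI] Ex 3.2 (i) p.70) [claim: Mochizuki2012, status: disputed] -/
theorem frobeniusBadAt_Dv (x : D.IndexCopy) (hx : x ∈ D.indexCopyBad) :
    (D.frobeniusBadAt B I x hx).Dv = CosetCat ↥(B x hx).H ∧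
      (D.frobeniusBadAt B I x hx).Ddash = CosetCat (D.GalAt x (D.not_mem_arc_of_mem_bad hx)) :=
  ⟨rfl, rfl⟩

include CG hA I in
/-- The Def. 3.1 (f) openness of `Π_{X̲→_K} ⊆ Π_{C_F}` from the kit binders `hA`, `CG` and FACT F-0240 in `I`
(abc-iut-L5-t2 `isOpen_PiXarrow_of_cuspGalois`). ([IUTchI] Def 3.1 (f) p.63) [claim: Mochizuki2012, status: disputed] -/
theorem isOpen_PiXarrow_of_mergeInputs : IsOpen (D.PiXarrow : Set D.PiC) :=
  haveI := D.isScalarTower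
  D.isOpen_PiXarrow_of_cuspGalois hA I.geomTFG CG

/-- **(S1) THE GENUINE GOOD LOCAL FROBENIOID AT A GOOD NONARCHIMEDEAN INDEX** — [IUTchI] Ex. 3.3 (i)(ii) for `D` at `v̲ = w ∣ p_v̲`
(abc-iut-L5-t2 `goodLocalFrobenioidAt` p419029 = `GoodLocalFrobenioid.ofGalois` at `K_w`, `Π_v̲ = Π_{X̲→_K} ×_{G_K} G_v̲`; E33 chain p461075 →
p470112 → p490831), `hX` DISCHARGED from `I.geomTFG`, `hA`, `CG`. ([IUTchI] Ex 3.3 (i)(ii) p.78) [claim: Mochizuki2012, status: disputed] -/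
def frobeniusGoodAt (x : D.IndexCopy) (hx : x ∉ D.indexCopyArc) [Fact (D.primeAt x hx).Prime] :
    @GoodLocalFrobenioid.{0} (D.primeAt x hx)
      (RescaledCompletion K (D.primeAt x hx) (D.specAt x hx) (D.primeAt_mem x hx)) _
      (GaloisValDatum.normVal _) :=
  haveI := D.isScalarTower
  haveI := D.normal_K
  D.goodLocalFrobenioidAt (D.specAt x hx) (D.primeAt x hx) (D.primeAt_mem x hx)
    (D.isOpen_PiXarrow_of_mergeInputs CG hA B I)

/-- **(S3) THE ARCHIMEDEAN LOCAL FROBENIOID AT AN ARCHIMEDEAN INDEX** — [IUTchI] Ex. 3.4 (i) with the REAL [FrdII] Ex. 3.3 `𝒞_v` at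
`K_v̲ ≅ ℂ` (`ArchLocalFrobenioid.ofArchFrd`; archimedean places of `K ∋ √−1` are complex; `𝒟_v`, `𝒜_{𝒟_v}` = the A3-INTERFACE convention,
as in abc-iut-L4-t14 C53ii/A1 p491595). ([IUTchI] Ex 3.4 (i) p.80) [claim: Mochizuki2012, status: disputed] -/
def frobeniusArcAt (_x : D.IndexCopy) (_hx : _x ∈ D.indexCopyArc) : ArchLocalFrobenioid.{0} ℂ :=
  ArchLocalFrobenioid.ofArchFrd

/-- **The type of the genuine local Frobenioid record named by an index** — by the trichotomy of Def. 3.1 (e):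
`v̲ ∈ V̲^bad` ([IUTchI] Ex. 3.2, `BadLocalFrobenioid l K_v̲`), `v̲ ∈ V̲^good ∩ V̲^non` (Ex. 3.3, `GoodLocalFrobenioid p_v̲ K_v̲`),
`v̲ ∈ V̲^arc` (Ex. 3.4, `ArchLocalFrobenioid ℂ`). ([IUTchI] Def 5.2 (i) p.134) [claim: Mochizuki2012, status: disputed] -/
inductive LocalFrobeniusRecord (x : D.IndexCopy) : Type 1
  /-- at a bad index: an [IUTchI] Ex. 3.2 datum over `K_v̲` -/
  | bad (hx : x ∈ D.indexCopyBad)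
      (Fr : BadLocalFrobenioid.{0} l
        (@GaloisValDatum.k _ (D.fact_primeAt_prime x (D.not_mem_arc_of_mem_bad hx)) (D.gvdAt x _))) :
      LocalFrobeniusRecord x
  /-- at a good nonarchimedean index: an [IUTchI] Ex. 3.3 datum over `K_v̲` -/
  | good (hx : x ∉ D.indexCopyBad) (hx' : x ∉ D.indexCopyArc) [hp : Fact (D.primeAt x hx').Prime]
      (Fr : @GoodLocalFrobenioid.{0} (D.primeAt x hx')
        (RescaledCompletion K (D.primeAt x hx') (D.specAt x hx') (D.primeAt_mem x hx')) _ (GaloisValDatum.normVal _)) :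
      LocalFrobeniusRecord x
  /-- at an archimedean index: an [IUTchI] Ex. 3.4 datum over `K_v̲ ≅ ℂ` -/
  | arc (hx : x ∈ D.indexCopyArc) (Fr : ArchLocalFrobenioid.{0} ℂ) : LocalFrobeniusRecord x

open Classical in
/-- **THE DICTIONARY `fModel x ↦ ℱ_x` — the genuine `ℱ`-prime-strip `{ℱ_v̲}_{v̲ ∈ V̲}` of the initial Θ-data as a dependent family over
the kit's copy of `V̲`**: bad ↦ `frobeniusBadAt` (tempered side through `I` only), good nonarchimedean ↦ `frobeniusGoodAt`, archimedean
↦ `frobeniusArcAt`; the Frobenioid CONTENT of the code `(genuineFKitOfBadLocal …).fModel x` (base = the kit's `𝒟_x` by `Iso.refl`, (S5)).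
([IUTchI] Def 5.2 (i) p.134) [claim: Mochizuki2012, status: disputed] -/
def frobeniusAt (x : D.IndexCopy) : D.LocalFrobeniusRecord x :=
  if hx : x ∈ D.indexCopyBad then .bad hx (D.frobeniusBadAt B I x hx)
  else if hx' : x ∈ D.indexCopyArc then .arc hx' (D.frobeniusArcAt x hx')
  else
    haveI : Fact (D.primeAt x hx').Prime := D.fact_primeAt_prime x hx'
    .good hx hx' (D.frobeniusGoodAt CG hA B I x hx')

open Classical in
/-- **(S2)** at a bad index the dictionary entry IS the genuine Ex. 3.2 datum `frobeniusBadAt`.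
([IUTchI] Ex 3.2 pp.69-73) [claim: Mochizuki2012, status: disputed] -/
theorem frobeniusAt_of_mem_bad (x : D.IndexCopy) (hx : x ∈ D.indexCopyBad) :
    D.frobeniusAt CG hA B I x = .bad hx (D.frobeniusBadAt B I x hx) := by
  rw [frobeniusAt, dif_pos hx]

open Classical in
/-- **(S3)** at an archimedean index the dictionary entry IS the Ex. 3.4 datum `frobeniusArcAt`.
([IUTchI] Ex 3.4 (i) p.80) [claim: Mochizuki2012, status: disputed] -/
theorem frobeniusAt_of_mem_arc (x : D.IndexCopy) (hx : x ∈ D.indexCopyArc) :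
    D.frobeniusAt CG hA B I x = .arc hx (D.frobeniusArcAt x hx) := by
  rw [frobeniusAt, dif_neg (fun h => D.not_mem_arc_of_mem_bad h hx), dif_pos hx]

open Classical in
/-- **(S1)** at a good nonarchimedean index the dictionary entry IS the genuine Ex. 3.3 datum `frobeniusGoodAt`.
([IUTchI] Ex 3.3 (i)(ii) p.78) [claim: Mochizuki2012, status: disputed] -/
theorem frobeniusAt_of_good (x : D.IndexCopy) (hx : x ∉ D.indexCopyBad) (hx' : x ∉ D.indexCopyArc) [Fact (D.primeAt x hx').Prime] :
    D.frobeniusAt CG hA B I x = .good hx hx' (D.frobeniusGoodAt CG hA B I x hx') := by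
  rw [frobeniusAt, dif_neg hx, dif_neg hx']

end Dictionary

/-! ### §3 (M1) the kit term -/

section Kit

variable (CG : D.geom.pe.CuspGalois) (hS : D.CuspClassesNormaliserStable) [Fact l.Prime]
  (M : D.TorsionMonodromy) (hA : D.geom.pe.ArrowCoveringClaims)
  (hI : ∀ k ∈ D.geom.pe.inertia D.geom.pe.ε1, M.tau (D.geom.embK k) = 0)
  (B : ∀ v, v ∈ D.indexCopyBad → D.BadPairAt v)
  (ΛBad : ∀ v (h : v ∈ D.indexCopyBad), D.LocalArrowLaw CG hS (B v h).H)
  {Gv : D.IndexCopy → Subgroup (Fbar ≃ₐ[F] Fbar)}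
  (ES : ∀ v, v ∈ D.indexCopyBad → EvalSectionBinder (D.localDataOfBadPairs CG hS M hA hI B ΛBad v) (Gv v))
  (I : D.MergeInputs B)

/-- **(M1) THE GENUINE `ℱ`-KIT over the genuine §6 base kit of record**: `ℱ_x`-, `ℱ^⊢_x`-, `ℱ̲_x`-objects = the isomorphs of `𝒟_x`
(codes; universes, module docstring), `𝔉 ↦ 𝔇` the inclusion, fully faithful — LABEL on `FAmb`/`toD`:
«isomorphisms of collections of data READ AS isomorphisms of their bases — Cor 5.3 (ii)/(iv) in kit form is thereby the recorded tautology
of 'FKit.ofBase'/'HodgeTheaterModel', NOT evidence for print»;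
`toD_model = Iso.refl` ((S5)); `𝔉 ↦ 𝔉^⊢` and `ℱ̲_v ↦ ℱ_v` identities on codes (at bad `v` the passage `ℱ̲_v ↦ 𝒞_v ⊆ ℱ̲_v` of Ex. 3.2 (iii) is the
field `(I.m1 x hx).Kt.hull` of the dictionary record); `‡𝔉^⊩` = (global part ∈ `I.m4.Glob`, `ℱ^⊢`-strip) ((S4)); `𝔉^⊢ ↦ 𝔇^⊢` through `M.mono`;
Frobenioid CONTENT of `fModel x` = the §2 dictionary `frobeniusAt`. ([IUTchI] Def 5.2 (i)-(iv) pp.134-135) [claim: Mochizuki2012, status: disputed] -/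
def genuineFKitOfBadLocal :
    (D.baseKitThetaNFOfBadPairs CG hS M hA hI B ΛBad).FKit (D.multKitThetaNFOfBadPairs CG hS M hA hI B ΛBad ES) where
  -- `FAmb`/`toD` LABEL: «isomorphisms of collections of data READ AS isomorphisms of their bases — Cor 5.3 (ii)/(iv) in kit
  -- form is thereby the recorded tautology of 'FKit.ofBase'/'HodgeTheaterModel', NOT evidence for print»
  FAmb x := ObjectProperty.FullSubcategory ((D.baseKitThetaNFOfBadPairs CG hS M hA hI B ΛBad).IsLocal x)
  fModel x := ⟨_, (D.baseKitThetaNFOfBadPairs CG hS M hA hI B ΛBad).isLocal_model x⟩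
  FmAmb x := ObjectProperty.FullSubcategory ((D.baseKitThetaNFOfBadPairs CG hS M hA hI B ΛBad).IsLocal x)
  fmModel x := ⟨_, (D.baseKitThetaNFOfBadPairs CG hS M hA hI B ΛBad).isLocal_model x⟩
  toD _ := ObjectProperty.ι _
  toD_model _ := Iso.refl _
  toFm _ := 𝟭 _
  toFm_model _ := Iso.refl _
  RlfAmb :=
    letI := I.m4.cat
    I.m4.Glob × ∀ x, ObjectProperty.FullSubcategory ((D.baseKitThetaNFOfBadPairs CG hS M hA hI B ΛBad).IsLocal x)
  catRlf := letI := I.m4.cat; inferInstance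
  rlfModel := (I.m4.gModel, fun x => ⟨_, (D.baseKitThetaNFOfBadPairs CG hS M hA hI B ΛBad).isLocal_model x⟩)
  rlfFm x := letI := I.m4.cat; CategoryTheory.Prod.snd _ _ ⋙ Pi.eval _ x
  rlfOf G := (I.m4.gModel, G)
  rlfOfMap φ := letI := I.m4.cat; Iso.prod (Iso.refl _) (Pi.isoMk φ)
  rlfFm_rlfOf _ _ := Iso.refl _
  ThAmb x := ObjectProperty.FullSubcategory ((D.baseKitThetaNFOfBadPairs CG hS M hA hI B ΛBad).IsLocal x)
  thModel x := ⟨_, (D.baseKitThetaNFOfBadPairs CG hS M hA hI B ΛBad).isLocal_model x⟩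
  thToF _ := 𝟭 _
  thToF_model _ := Iso.refl _
  toDm G := (D.multKitThetaNFOfBadPairs CG hS M hA hI B ΛBad ES).mono ⟨fun v => (G v).obj, fun v => (G v).property⟩
  toDmMap φ := (D.multKitThetaNFOfBadPairs CG hS M hA hI B ΛBad ES).monoMap fun v => (ObjectProperty.ι _).mapIso (φ v)
  toDm_toFm _ _ := ⟨𝟙 _⟩

/-- **(S5)** the base of the model `ℱ_x` IS the kit's model `𝒟_x`, by the identity. ([IUTchI] Def 5.2 (i) p.134) [claim: Mochizuki2012, status: disputed] -/
theorem genuineFKitOfBadLocal_toD_model (x : D.IndexCopy) :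
    (D.genuineFKitOfBadLocal CG hS M hA hI B ΛBad ES I).toD_model x = Iso.refl _ := rfl

/-- **(S4)** the global part of the kit's model `𝔉^⊩_mod` IS `I.m4.gModel`. ([IUTchI] Def 5.2 (iv) p.135) [claim: Mochizuki2012, status: disputed] -/
theorem genuineFKitOfBadLocal_rlfModel_fst : (D.genuineFKitOfBadLocal CG hS M hA hI B ΛBad ES I).rlfModel.1 = I.m4.gModel := rfl

/-- **The kit's model `𝒟_x` at a bad index has underlying group the pair's `Π_{X̳̲_v̲} = (B x hx).H`** — the group over whose coset
category `frobeniusBadAt` is formed (`frobeniusBadAt_Dv`): the (S2)/(S5) junction. ([IUTchI] Def 6.1 (ii) p.156) [claim: Mochizuki2012, status: disputed] -/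
theorem sub_model_eq_of_mem_bad (x : D.IndexCopy) (hx : x ∈ D.indexCopyBad) :
    ((D.baseKitThetaNFOfBadPairs CG hS M hA hI B ΛBad).model x).sub = (B x hx).H := by
  haveI := M.normal_PiXund_subgroupOf_PiXK
  change OrbitCat.sub (D.localDataOfBadPairs CG hS M hA hI B ΛBad x).locObj = _
  rw [LocalDatum.locObj, D.localDatumAt_H, D.localGroupAt_of_mem B hx, OrbitCat.sub_of]

end Kit

end InitialThetaData

end Literature.IUT.HodgeTheaters

end
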